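import Summits.BirchSwinnertonDyer.BirchSwinnertonDyer.Theorems.Rank1ResidualJetCoreVertexBridgeNoCV
import Summits.BirchSwinnertonDyer.BirchSwinnertonDyer.Theorems.Rank1ResidualJetCarrierEndFormsNamedPrintOnly
import HarnessLib

/-!
# T1 JET (cell `bsd-jet`), road K — STRIKE K5, step 5: the END FORMS «named print only, NO reading
# binder» — K3 ∕ K1 ∕ K4 ⟸ {[McC] Prop. 5.2, [McC] Prop. 4.4, Poitou–Tate for Selmer structures,
# [GZ86 III (3.1)] (receptacle schema at square-free Kolyvagin conductors)}

HONEST FRAMING (programme file `BSD-LIT2PART-PROGRAMME-v1.md` §HONESTY, verbatim): «no tranche here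
proves BSD; ARM L moves the LITERAL column of an r ≤ 1 census into the kernel-proved-modulo-named-print
column; ARM P changes what «named print» is worth.» THEOREMS ONLY (seat `bsd-jet-pv-1`, session g8;
`--supports stmt-BirchSwinnertonDyer-14418`, helper); nothing is booked, no flag is struck by this
file, 0 classes move (road K is DOCUMENTARY); K1 ∕ K3 ∕ K4 stay `@[conjecture]`.

WHAT THIS FILE DOES. pv-2's END FORMS `JET.jetchevDivisibilityCarrier{Mult,Ne,Add}_of_namedPrintOnly`
(`Rank1ResidualJetCarrierEndFormsNamedPrintOnly.lean`) derive the three reading binders K3 ∕ K1 ∕ K4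
(`JET.JetchevDivisibilityCarrier{Mult,Ne,Add}` = Jetchev 2008 Thm. 1.4 ∕ Cor. 1.5 READ at a carrier
`q ∣ N` with `p ∣ c_q`: `q = p` multiplicative, `q ≠ p`, `q = p` additive) from FIVE named inputs
{`h52` [McC 5.2], `hCV` K5, `h44` [McC 4.4], `hPT`, `hGZ` [GZ86 III (3.1)] scoped + guarded}. Four of
them are PUBLISHED statements; K5 = `JET.JetchevCoreVertexExistence` (Jetchev Prop. 5.3 «core vertices
exist» READ at `p ∣ N`) is a READING. Here K5 is gone:
`jetchevDivisibilityCarrier{Mult,Ne,Add}_of_namedPrintNoCV : h52 → h44 → hPT → hGZ → K3 ∕ K1 ∕ K4` — the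
bodies are pv-2's `…_of_namedPrint` proofs VERBATIM (H63 line «v3»
`tamagawaExponent_le_mInfty_of_localFactsPrime_v3`, `h49str` fed by pv-1 g7's
`localization_kolyvaginClass_mem_stringentFamily_carrier_kolyvagin` as in `…_of_namedPrintOnly`), run
over the K5-free bridge `jetchevDivisibilityCarrier{Mult,Ne,Add}_of_prop52_of_namedPrint_H63`
(`Rank1ResidualJetCoreVertexBridgeNoCV.lean`, this seat), in which Prop. 5.3 is the KERNEL theorem
`jetchevCoreVertexExistence_lt_of_namedPrint` (the full Prop. 6.4 walk `JET.Section6.exists_coreVertex_adm`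
on the row objects, cell bsd-stepL's bricks at general `p`). ROAD-K RESIDUAL AFTER THIS FILE, by name:
NAMED PRINT ONLY, ALL PUBLISHED — {`McCallum1991.prop52_exists_conductor_kolyvaginClass_order_eq`
[McC 5.2], `McCallum1991.prop44_localOrder_kolyvaginClass_mul_eq` [McC 4.4],
`poitouTate_selmerStructure_duality_conj` (Poitou–Tate for Selmer structures, conjugation form),
[GZ86 III (3.1)] in the receptacle form at square-free Kolyvagin conductors (the guarded scoped schema;
fed in frame by `JET.hGZ_of_Gross1991` from `Gross1991_heegnerPoint_sub_ratTorsion_mem_E0`)} — no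
reading binder, no local print-to-type hypothesis, no kernel gap.
References: [cite: Jetchev2008, Thm. 1.4 (p. 812), Thm. 5.2 (p. 821), Prop. 4.9 (p. 820), Prop. 5.3
(p. 823), Proof of Thm. 1.1 (p. 824)] [cite: McCallumLMS1991, §3 Cor. 3.2, §4 Prop. 4.4, §5 Prop. 5.2]
[cite: GrossLMS1991, §3 (3.1), Prop. 5.4, Prop. 6.2 (1)] [cite: GrossZagier1986, III (3.1)]
[cite: Howard2004HeegnerKolyvagin, Lemma 2.7.3] [cite: MilneADT2006, Ch. I, Prop. 3.8, Thm. 4.10(b)].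
-/

set_option autoImplicit false

noncomputable section

open scoped Classical Pointwise

open WeierstrassCurve IsDedekindDomain NumberField Field Literature.NumberTheory.EllipticCurves
  Literature.NumberTheory.EllipticCurves.ModularForms Literature.NumberTheory.EllipticCurves.Jetchev2008
  Literature.NumberTheory.GaloisRepresentations Literature.NumberTheory.GaloisCohomology
  Literature.NumberTheory.GaloisRepresentations.DiscreteGaloisModule
  Summit.BirchSwinnertonDyer.Rank1Residual.X11b Summit.BirchSwinnertonDyer.Rank1Residual.X11b.Three
  Summit.BirchSwinnertonDyer.Rank1Residual.JET.SelmerVocabulary Literature.NumberTheory.Automorphic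

namespace Summit.BirchSwinnertonDyer.Rank1Residual.JET

/-- **K3 ⟸ NAMED PRINT ONLY, NO reading binder** {[McC] Prop. 5.2, [McC] Prop. 4.4, Poitou–Tate,
[GZ86 III (3.1)] (scoped, guarded)}: Jetchev Thm. 1.4 ∕ Cor. 1.5 read at a multiplicative carrier
`p ∣ N`. Body = pv-2's `jetchevDivisibilityCarrierMult_of_namedPrint` over the K5-free bridge.
[cite: Jetchev2008, Thm. 1.4, Thm. 5.2, Prop. 4.9, Prop. 5.3] [cite: McCallumLMS1991, Prop. 4.4, Prop. 5.2]
[cite: GrossZagier1986, III (3.1)] -/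
theorem jetchevDivisibilityCarrierMult_of_namedPrintNoCV
    (h52 : McCallum1991.prop52_exists_conductor_kolyvaginClass_order_eq)
    (h44 : McCallum1991.prop44_localOrder_kolyvaginClass_mul_eq)
    (hPT : ∀ (K : Type) [Field K] [NumberField K], poitouTate_selmerStructure_duality_conj K)
    (hGZ : ∀ (W : WeierstrassCurve ℚ) [W.IsElliptic] [W.IsGloballyMinimal] [NeZero (W.conductorNorm ℤ)]
      (K : Type) [Field K] [NumberField K], IsImaginaryQuadratic K →
      NumberField.discr K ≠ -3 → NumberField.discr K ≠ -4 →
      SatisfiesHeegnerHypothesis (W.conductorNorm ℤ) K →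
      ∀ (p : ℕ) [Fact p.Prime], p ≠ 2 → W.HasSurjectiveModNGaloisRep p →
      ∀ (Dt : ModularParametrizationData W (W.conductorNorm ℤ)) (β : ℤ) (ι : K →+* ℂ)
      [∀ j : ℕ, NumberField (ringClassField K ι j)],
      ∃ n' : ℤ, IsCoprime (p : ℤ) n' ∧ ∀ (m : ℕ), Squarefree m →
        (∀ q ∈ m.primeFactors, Zhang2014.IsKolyvaginPrime (W.conductorNorm ℤ) W K p q) →
        ∀ (dm : KolyvaginHeegnerData Dt β ι m)
        (γ : ringClassField K ι m ≃ₐ[ℚ] ringClassField K ι m), γ ∈ ringClassGal ι m →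
        ∀ v : HeightOneSpectrum (𝓞 K), ¬ (W.baseChange K).HasGoodReductionAt v →
          n' • pointsMap (W.baseChange K) (v.adicCompletion K)
              (dm.toGeomPoints (pointGalHom W (ringClassField K ι m) γ dm.y)) ∈
            E0Receptacle (W.baseChange K) v ∧
          ∀ (ℓ : ℕ), ℓ ∈ m.primeFactors → ∀ (dm' : KolyvaginHeegnerData Dt β ι (m / ℓ))
            (hle : ringClassField K ι (m / ℓ) ≤ ringClassField K ι m),
            n' • pointsMap (W.baseChange K) (v.adicCompletion K)
                (dm.toGeomPoints (pointGalHom W (ringClassField K ι m) γ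
                  (WeierstrassCurve.Affine.Point.map (W' := W)
                    ((RingClassField.inclusion ι hle).restrictScalars ℚ) dm'.y))) ∈
              E0Receptacle (W.baseChange K) v) :
    JetchevDivisibilityCarrierMult := by
  refine jetchevDivisibilityCarrierMult_of_prop52_of_namedPrint_H63 h52 h44 hPT hGZ ?_
  intro W _ _ _ hcm K _ _ hK hD3 hD4 hH τ hτ p _ hp2 hmult htower Dt β ι _ d₁ _ mdiv m hmdiv hm mInf
    _ _ k c hk hcore hmc hkM htk hik
  have hp : p.Prime := Fact.out
  -- trivial case: `p ∤ c_p`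
  by_cases ht0 : padicValNat p ((W.baseChange ℚ_[p]).localTamagawaNumber ℤ_[p]) = 0
  · rw [ht0]; exact Nat.zero_le _
  have hdvd : p ∣ (W.baseChange ℚ_[p]).localTamagawaNumber ℤ_[p] :=
    dvd_of_one_le_padicValNat (Nat.one_le_iff_ne_zero.mpr ht0)
  -- the carrier place `v₀ ∣ p`, split, and the transport of the row data
  obtain ⟨v₀, hv₀, hv₀N, hpv₀⟩ := exists_split_carrier_place W K hK τ hτ hH p hmult
  obtain ⟨hminK, hminP, hcEq, hc0, hcyc⟩ := carrierRowData_of_split W K p hK τ v₀ hv₀ hpv₀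
  haveI := hminK
  haveI := hminP
  haveI := hcyc (kodairaNeron_isAddCyclic_forall W p p hp2 hdvd)
  -- `τ² = 1`
  haveI : Algebra.IsQuadraticExtension ℚ K := ⟨hK.1⟩
  have hτ2 : τ * τ = 1 := by
    have hcard : Nat.card (K ≃ₐ[ℚ] K) = 2 := by rw [IsGalois.card_aut_eq_finrank, hK.1]
    obtain ⟨y, -, hyu⟩ := (Nat.card_eq_two_iff' (1 : K ≃ₐ[ℚ] K)).mp hcard
    have h1 : τ = y := hyu τ hτ
    have h2 : τ⁻¹ = y := hyu τ⁻¹ (inv_ne_one.mpr hτ)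
    rw [mul_eq_one_iff_eq_inv]
    exact h1.trans h2.symm
  -- instances at level `p^k`
  haveI : NeZero (p ^ k) := ⟨pow_ne_zero k hp.ne_zero⟩
  haveI : Finite (geomTorsion (W.baseChange K) ((p ^ k : ℕ) : ℤ)) :=
    finite_geomTorsion_of_neZero (W.baseChange K) (p ^ k)
  have hn : ((p ^ k : ℕ) : ℤ) ≠ 0 := by exact_mod_cast pow_ne_zero k hp.ne_zero
  -- the named-print schema [GZ86 III (3.1)] at this frame
  have hρ : W.HasSurjectiveModNGaloisRep p := by simpa using htower 1
  obtain ⟨n', hcop', hGZ'⟩ := hGZ W K hK hD3 hD4 hH p hp2 hρ Dt β ι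
  -- Kolyvagin data of the core vertex
  have hkc : (k : ℕ∞) ≤ Zhang2014.levelIndex W p c.1 := le_trans le_self_add hkM
  have hcK : ∀ ℓ ∈ c.1.primeFactors, Zhang2014.IsKolyvaginPrime (W.conductorNorm ℤ) W K p ℓ ∧
      k ≤ Zhang2014.kolyvaginIndex W p ℓ := fun ℓ hℓ ↦
    ⟨c.2.2 ℓ hℓ, Zhang2014.natCast_le_levelIndex_iff.mp hkc ℓ hℓ⟩
  -- the exponent
  have hfac : (((W.baseChange K).baseChange (v₀.adicCompletion K)).localTamagawaNumber
      (v₀.adicCompletionIntegers K)).factorization p =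
      padicValNat p ((W.baseChange ℚ_[p]).localTamagawaNumber ℤ_[p]) := by
    rw [hcEq, Nat.factorization_def _ hp]
  have htk' : (((W.baseChange K).baseChange (v₀.adicCompletion K)).localTamagawaNumber
      (v₀.adicCompletionIntegers K)).factorization p < k := by rw [hfac]; exact htk
  -- the H63 line «v3» with `h49str` (Jetchev Prop. 4.9 proper at the carrier pair) FED BY NAME (pv-1 g7)
  have key := tamagawaExponent_le_mInfty_of_localFactsPrime_v3 h44 W hcm K hK hD3 hD4 hH (hPT K) p hp2
    htower Dt β ι τ hτ hτ2 hcop' hGZ' mdiv m hmdiv hm k hn c hk hcore mInf hmc hkM hik v₀ hv₀ hv₀N hc0 htk'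
    (fun ℓ h1 h2 h3 d' q hq ↦ localization_kolyvaginClass_mem_stringentFamily_carrier_kolyvagin W K hK hD3
      hD4 hH hp2 hρ Dt β ι hcop' hGZ' τ hn c.2.1 hcK v₀ hv₀N ℓ h1 h2 h3 d' q hq)
  rw [hfac] at key
  exact key

/-- **K1 ⟸ NAMED PRINT ONLY, NO reading binder** (carrier a prime `q ∣ N`, `q ≠ p`).
[cite: Jetchev2008, Thm. 1.4, Thm. 5.2, Prop. 4.9, Prop. 5.3] [cite: McCallumLMS1991, Prop. 4.4, Prop. 5.2]
[cite: GrossZagier1986, III (3.1)] -/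
theorem jetchevDivisibilityCarrierNe_of_namedPrintNoCV
    (h52 : McCallum1991.prop52_exists_conductor_kolyvaginClass_order_eq)
    (h44 : McCallum1991.prop44_localOrder_kolyvaginClass_mul_eq)
    (hPT : ∀ (K : Type) [Field K] [NumberField K], poitouTate_selmerStructure_duality_conj K)
    (hGZ : ∀ (W : WeierstrassCurve ℚ) [W.IsElliptic] [W.IsGloballyMinimal] [NeZero (W.conductorNorm ℤ)]
      (K : Type) [Field K] [NumberField K], IsImaginaryQuadratic K →
      NumberField.discr K ≠ -3 → NumberField.discr K ≠ -4 →
      SatisfiesHeegnerHypothesis (W.conductorNorm ℤ) K →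
      ∀ (p : ℕ) [Fact p.Prime], p ≠ 2 → W.HasSurjectiveModNGaloisRep p →
      ∀ (Dt : ModularParametrizationData W (W.conductorNorm ℤ)) (β : ℤ) (ι : K →+* ℂ)
      [∀ j : ℕ, NumberField (ringClassField K ι j)],
      ∃ n' : ℤ, IsCoprime (p : ℤ) n' ∧ ∀ (m : ℕ), Squarefree m →
        (∀ q ∈ m.primeFactors, Zhang2014.IsKolyvaginPrime (W.conductorNorm ℤ) W K p q) →
        ∀ (dm : KolyvaginHeegnerData Dt β ι m)
        (γ : ringClassField K ι m ≃ₐ[ℚ] ringClassField K ι m), γ ∈ ringClassGal ι m →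
        ∀ v : HeightOneSpectrum (𝓞 K), ¬ (W.baseChange K).HasGoodReductionAt v →
          n' • pointsMap (W.baseChange K) (v.adicCompletion K)
              (dm.toGeomPoints (pointGalHom W (ringClassField K ι m) γ dm.y)) ∈
            E0Receptacle (W.baseChange K) v ∧
          ∀ (ℓ : ℕ), ℓ ∈ m.primeFactors → ∀ (dm' : KolyvaginHeegnerData Dt β ι (m / ℓ))
            (hle : ringClassField K ι (m / ℓ) ≤ ringClassField K ι m),
            n' • pointsMap (W.baseChange K) (v.adicCompletion K)
                (dm.toGeomPoints (pointGalHom W (ringClassField K ι m) γ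
                  (WeierstrassCurve.Affine.Point.map (W' := W)
                    ((RingClassField.inclusion ι hle).restrictScalars ℚ) dm'.y))) ∈
              E0Receptacle (W.baseChange K) v) :
    JetchevDivisibilityCarrierNe := by
  refine jetchevDivisibilityCarrierNe_of_prop52_of_namedPrint_H63 h52 h44 hPT hGZ ?_
  intro W _ _ _ hcm K _ _ hK hD3 hD4 hH τ hτ p _ hp2 htower Dt β ι _ d₁ _ q _ hqN _ mdiv m hmdiv hm mInf
    _ _ k c hk hcore hmc hkM htk hik
  have hp : p.Prime := Fact.out
  -- trivial case: `p ∤ c_q`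
  by_cases ht0 : padicValNat p ((W.baseChange ℚ_[q]).localTamagawaNumber ℤ_[q]) = 0
  · rw [ht0]; exact Nat.zero_le _
  have hdvd : p ∣ (W.baseChange ℚ_[q]).localTamagawaNumber ℤ_[q] :=
    dvd_of_one_le_padicValNat (Nat.one_le_iff_ne_zero.mpr ht0)
  -- the carrier place `v₀ ∣ q`, split, and the transport of the row data
  obtain ⟨v₀, hv₀, hv₀N, hqv₀⟩ := exists_split_place_of_dvd K hK τ hτ hH q hqN
  obtain ⟨hminK, hminP, hcEq, hc0, hcyc⟩ := carrierRowData_of_split W K q hK τ v₀ hv₀ hqv₀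
  haveI := hminK
  haveI := hminP
  haveI := hcyc (kodairaNeron_isAddCyclic_forall W q p hp2 hdvd)
  -- `τ² = 1`
  haveI : Algebra.IsQuadraticExtension ℚ K := ⟨hK.1⟩
  have hτ2 : τ * τ = 1 := by
    have hcard : Nat.card (K ≃ₐ[ℚ] K) = 2 := by rw [IsGalois.card_aut_eq_finrank, hK.1]
    obtain ⟨y, -, hyu⟩ := (Nat.card_eq_two_iff' (1 : K ≃ₐ[ℚ] K)).mp hcard
    have h1 : τ = y := hyu τ hτ
    have h2 : τ⁻¹ = y := hyu τ⁻¹ (inv_ne_one.mpr hτ)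
    rw [mul_eq_one_iff_eq_inv]
    exact h1.trans h2.symm
  -- instances at level `p^k`
  haveI : NeZero (p ^ k) := ⟨pow_ne_zero k hp.ne_zero⟩
  haveI : Finite (geomTorsion (W.baseChange K) ((p ^ k : ℕ) : ℤ)) :=
    finite_geomTorsion_of_neZero (W.baseChange K) (p ^ k)
  have hn : ((p ^ k : ℕ) : ℤ) ≠ 0 := by exact_mod_cast pow_ne_zero k hp.ne_zero
  -- the named-print schema [GZ86 III (3.1)] at this frame
  have hρ : W.HasSurjectiveModNGaloisRep p := by simpa using htower 1
  obtain ⟨n', hcop', hGZ'⟩ := hGZ W K hK hD3 hD4 hH p hp2 hρ Dt β ι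
  -- Kolyvagin data of the core vertex
  have hkc : (k : ℕ∞) ≤ Zhang2014.levelIndex W p c.1 := le_trans le_self_add hkM
  have hcK : ∀ ℓ ∈ c.1.primeFactors, Zhang2014.IsKolyvaginPrime (W.conductorNorm ℤ) W K p ℓ ∧
      k ≤ Zhang2014.kolyvaginIndex W p ℓ := fun ℓ hℓ ↦
    ⟨c.2.2 ℓ hℓ, Zhang2014.natCast_le_levelIndex_iff.mp hkc ℓ hℓ⟩
  -- the exponent
  have hfac : (((W.baseChange K).baseChange (v₀.adicCompletion K)).localTamagawaNumber
      (v₀.adicCompletionIntegers K)).factorization p =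
      padicValNat p ((W.baseChange ℚ_[q]).localTamagawaNumber ℤ_[q]) := by
    rw [hcEq, Nat.factorization_def _ hp]
  have htk' : (((W.baseChange K).baseChange (v₀.adicCompletion K)).localTamagawaNumber
      (v₀.adicCompletionIntegers K)).factorization p < k := by rw [hfac]; exact htk
  -- the H63 line «v3» with `h49str` (Jetchev Prop. 4.9 proper at the carrier pair) FED BY NAME (pv-1 g7)
  have key := tamagawaExponent_le_mInfty_of_localFactsPrime_v3 h44 W hcm K hK hD3 hD4 hH (hPT K) p hp2
    htower Dt β ι τ hτ hτ2 hcop' hGZ' mdiv m hmdiv hm k hn c hk hcore mInf hmc hkM hik v₀ hv₀ hv₀N hc0 htk'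
    (fun ℓ h1 h2 h3 d' q hq ↦ localization_kolyvaginClass_mem_stringentFamily_carrier_kolyvagin W K hK hD3
      hD4 hH hp2 hρ Dt β ι hcop' hGZ' τ hn c.2.1 hcK v₀ hv₀N ℓ h1 h2 h3 d' q hq)
  rw [hfac] at key
  exact key

/-- **K4 ⟸ NAMED PRINT ONLY, NO reading binder** (carrier `p`, `E` additive at `p`).
[cite: Jetchev2008, Thm. 1.4, Thm. 5.2, Prop. 4.9, Prop. 5.3] [cite: McCallumLMS1991, Prop. 4.4, Prop. 5.2]
[cite: GrossZagier1986, III (3.1)] -/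
theorem jetchevDivisibilityCarrierAdd_of_namedPrintNoCV
    (h52 : McCallum1991.prop52_exists_conductor_kolyvaginClass_order_eq)
    (h44 : McCallum1991.prop44_localOrder_kolyvaginClass_mul_eq)
    (hPT : ∀ (K : Type) [Field K] [NumberField K], poitouTate_selmerStructure_duality_conj K)
    (hGZ : ∀ (W : WeierstrassCurve ℚ) [W.IsElliptic] [W.IsGloballyMinimal] [NeZero (W.conductorNorm ℤ)]
      (K : Type) [Field K] [NumberField K], IsImaginaryQuadratic K →
      NumberField.discr K ≠ -3 → NumberField.discr K ≠ -4 →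
      SatisfiesHeegnerHypothesis (W.conductorNorm ℤ) K →
      ∀ (p : ℕ) [Fact p.Prime], p ≠ 2 → W.HasSurjectiveModNGaloisRep p →
      ∀ (Dt : ModularParametrizationData W (W.conductorNorm ℤ)) (β : ℤ) (ι : K →+* ℂ)
      [∀ j : ℕ, NumberField (ringClassField K ι j)],
      ∃ n' : ℤ, IsCoprime (p : ℤ) n' ∧ ∀ (m : ℕ), Squarefree m →
        (∀ q ∈ m.primeFactors, Zhang2014.IsKolyvaginPrime (W.conductorNorm ℤ) W K p q) →
        ∀ (dm : KolyvaginHeegnerData Dt β ι m)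
        (γ : ringClassField K ι m ≃ₐ[ℚ] ringClassField K ι m), γ ∈ ringClassGal ι m →
        ∀ v : HeightOneSpectrum (𝓞 K), ¬ (W.baseChange K).HasGoodReductionAt v →
          n' • pointsMap (W.baseChange K) (v.adicCompletion K)
              (dm.toGeomPoints (pointGalHom W (ringClassField K ι m) γ dm.y)) ∈
            E0Receptacle (W.baseChange K) v ∧
          ∀ (ℓ : ℕ), ℓ ∈ m.primeFactors → ∀ (dm' : KolyvaginHeegnerData Dt β ι (m / ℓ))
            (hle : ringClassField K ι (m / ℓ) ≤ ringClassField K ι m),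
            n' • pointsMap (W.baseChange K) (v.adicCompletion K)
                (dm.toGeomPoints (pointGalHom W (ringClassField K ι m) γ
                  (WeierstrassCurve.Affine.Point.map (W' := W)
                    ((RingClassField.inclusion ι hle).restrictScalars ℚ) dm'.y))) ∈
              E0Receptacle (W.baseChange K) v) :
    JetchevDivisibilityCarrierAdd := by
  refine jetchevDivisibilityCarrierAdd_of_prop52_of_namedPrint_H63 h52 h44 hPT hGZ ?_
  intro W _ _ _ hcm K _ _ hK hD3 hD4 hH τ hτ p _ hp2 hngood _ htower Dt β ι _ d₁ _ mdiv m hmdiv hm mInf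
    _ _ k c hk hcore hmc hkM htk hik
  have hp : p.Prime := Fact.out
  -- trivial case: `p ∤ c_p`
  by_cases ht0 : padicValNat p ((W.baseChange ℚ_[p]).localTamagawaNumber ℤ_[p]) = 0
  · rw [ht0]; exact Nat.zero_le _
  have hdvd : p ∣ (W.baseChange ℚ_[p]).localTamagawaNumber ℤ_[p] :=
    dvd_of_one_le_padicValNat (Nat.one_le_iff_ne_zero.mpr ht0)
  -- the carrier place `v₀ ∣ p` (`p ∣ N`: bad reduction), split, and the transport of the row data
  have hpN : p ∣ W.conductorNorm ℤ := (W.dvd_conductorNorm_iff_not_hasGoodReductionAtPrime p).mpr hngood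
  obtain ⟨v₀, hv₀, hv₀N, hpv₀⟩ := exists_split_place_of_dvd K hK τ hτ hH p hpN
  obtain ⟨hminK, hminP, hcEq, hc0, hcyc⟩ := carrierRowData_of_split W K p hK τ v₀ hv₀ hpv₀
  haveI := hminK
  haveI := hminP
  haveI := hcyc (kodairaNeron_isAddCyclic_forall W p p hp2 hdvd)
  -- `τ² = 1`
  haveI : Algebra.IsQuadraticExtension ℚ K := ⟨hK.1⟩
  have hτ2 : τ * τ = 1 := by
    have hcard : Nat.card (K ≃ₐ[ℚ] K) = 2 := by rw [IsGalois.card_aut_eq_finrank, hK.1]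
    obtain ⟨y, -, hyu⟩ := (Nat.card_eq_two_iff' (1 : K ≃ₐ[ℚ] K)).mp hcard
    have h1 : τ = y := hyu τ hτ
    have h2 : τ⁻¹ = y := hyu τ⁻¹ (inv_ne_one.mpr hτ)
    rw [mul_eq_one_iff_eq_inv]
    exact h1.trans h2.symm
  -- instances at level `p^k`
  haveI : NeZero (p ^ k) := ⟨pow_ne_zero k hp.ne_zero⟩
  haveI : Finite (geomTorsion (W.baseChange K) ((p ^ k : ℕ) : ℤ)) :=
    finite_geomTorsion_of_neZero (W.baseChange K) (p ^ k)
  have hn : ((p ^ k : ℕ) : ℤ) ≠ 0 := by exact_mod_cast pow_ne_zero k hp.ne_zero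
  -- the named-print schema [GZ86 III (3.1)] at this frame
  have hρ : W.HasSurjectiveModNGaloisRep p := by simpa using htower 1
  obtain ⟨n', hcop', hGZ'⟩ := hGZ W K hK hD3 hD4 hH p hp2 hρ Dt β ι
  -- Kolyvagin data of the core vertex
  have hkc : (k : ℕ∞) ≤ Zhang2014.levelIndex W p c.1 := le_trans le_self_add hkM
  have hcK : ∀ ℓ ∈ c.1.primeFactors, Zhang2014.IsKolyvaginPrime (W.conductorNorm ℤ) W K p ℓ ∧
      k ≤ Zhang2014.kolyvaginIndex W p ℓ := fun ℓ hℓ ↦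
    ⟨c.2.2 ℓ hℓ, Zhang2014.natCast_le_levelIndex_iff.mp hkc ℓ hℓ⟩
  -- the exponent
  have hfac : (((W.baseChange K).baseChange (v₀.adicCompletion K)).localTamagawaNumber
      (v₀.adicCompletionIntegers K)).factorization p =
      padicValNat p ((W.baseChange ℚ_[p]).localTamagawaNumber ℤ_[p]) := by
    rw [hcEq, Nat.factorization_def _ hp]
  have htk' : (((W.baseChange K).baseChange (v₀.adicCompletion K)).localTamagawaNumber
      (v₀.adicCompletionIntegers K)).factorization p < k := by rw [hfac]; exact htk
  -- the H63 line «v3» with `h49str` (Jetchev Prop. 4.9 proper at the carrier pair) FED BY NAME (pv-1 g7)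
  have key := tamagawaExponent_le_mInfty_of_localFactsPrime_v3 h44 W hcm K hK hD3 hD4 hH (hPT K) p hp2
    htower Dt β ι τ hτ hτ2 hcop' hGZ' mdiv m hmdiv hm k hn c hk hcore mInf hmc hkM hik v₀ hv₀ hv₀N hc0 htk'
    (fun ℓ h1 h2 h3 d' q hq ↦ localization_kolyvaginClass_mem_stringentFamily_carrier_kolyvagin W K hK hD3
      hD4 hH hp2 hρ Dt β ι hcop' hGZ' τ hn c.2.1 hcK v₀ hv₀N ℓ h1 h2 h3 d' q hq)
  rw [hfac] at key
  exact key

end Summit.BirchSwinnertonDyer.Rank1Residual.JET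

end
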